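import Literature.LinearAlgebra.TensorNetworks.QTTLaplaceMulti
import Literature.Analysis.Matrix.KroneckerSumExp
import HarnessLib

/-!
# The exponential of the `D`-dimensional Laplace-like Kronecker sum factorises

Topic `Literature/LinearAlgebra/TensorNetworks`; namespace
`Literature.LinearAlgebra.TensorNetworks`.

Grasedyck [Grasedyck2004, §3] considers matrices of the *tensor structure*
`A = Σ_{i=1}^d Â_i`, `Â_i = I ⊗ ⋯ ⊗ I ⊗ A_i ⊗ I ⊗ ⋯ ⊗ I` (eq. (2)) — in the tree this is exactly the
Kazeev–Khoromskij Laplace-like operator `laplaceMulti a Δ = Σ_k a_k · I ⊗ ⋯ ⊗ Δ_k ⊗ ⋯ ⊗ I`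
([KazeevKhoromskij2012, eq. (3)], `QTTLaplaceMulti.lean`, built from the `D`-fold Kronecker product
`kronPi`) — and records in the proof of his Lemma 2 the identity on which the whole
exponential-sum / low-Kronecker-rank approximation of `A⁻¹` rests:

  `exp(tA) = exp(t Σ_i Â_i) = ∏_i exp(t Â_i)   (the Â_i commute)   = ⊗_{i=1}^d exp(t A_i)`.

For two factors this is Bernstein's `e^{A ⊕ B} = e^A ⊗ e^B` ([Bernstein2009, Prop. 11.1.7]), in the
tree as `Literature.Analysis.Matrix.KroneckerSum.exp_kroneckerSum` (`KroneckerSumExp.lean`).  This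
file proves the `D`-factor statement for `kronPi` / `laplaceMulti`:

* `kronPi_update_one_eq_reindex`: the one-slot Kronecker factor `I ⊗ ⋯ ⊗ A ⊗ ⋯ ⊗ I` (slot `k`) is
  `A ⊗ₖ I` re-indexed along `Equiv.funSplitAt k` — the bridge to Mathlib's binary `⊗ₖ`;
* `commute_kronPi_update_one`: one-slot factors in different slots commute (Grasedyck's
  'the `Â_i` commute'); `kronPi_update_one_mul_of_ne`;
* `exp_kronPi_update_one : exp (I ⊗ ⋯ ⊗ A ⊗ ⋯ ⊗ I) = I ⊗ ⋯ ⊗ exp A ⊗ ⋯ ⊗ I`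
  (Bernstein (11.1.14)/(11.1.15) in an arbitrary slot);
* `noncommProd_kronPi_update_one`: `∏_{k ∈ s} (I ⊗ ⋯ ⊗ F_k ⊗ ⋯ ⊗ I) = ⊗_k (k ∈ s ? F_k : I)`;
* `exp_sum_kronPi_update_one : exp (Σ_k I ⊗ ⋯ ⊗ E_k ⊗ ⋯ ⊗ I) = ⊗_k exp E_k` (Lemma 2, proof);
* `laplaceMulti_eq_sum_kronPi_update` (eq. (2) ↔ K–K eq. (3)), `smul_laplaceMulti`, and the
  headline `exp_laplaceMulti : exp (laplaceMulti a Δ) = ⊗_k exp (a_k Δ_k)`,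
  `exp_smul_laplaceMulti : exp (t · laplaceMulti a Δ) = ⊗_k exp ((t a_k) Δ_k)` — the heat semigroup
  of the `D`-dimensional discrete operator is the Kronecker product of the one-dimensional ones;
* `exp_laplaceMulti_mulVec_prod`: separable data stay separable,
  `exp(Δ^{(D)}) (⊗_k x_k) = ⊗_k (exp(a_k Δ_k) x_k)` — Grasedyck §5, "the solution `x(t)` is
  `⊗_{i=1}^d exp(tA_i) b_i`" (product vectors written `i ↦ ∏_k x_k(i_k)`;
  the named tensor product of vectors `tensorPi` and `(⊗A_k)(⊗x_k) = ⊗(A_k x_k)` live in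
  `QTTLaplaceMultiSpectrum.lean`, as does the weights-outside form `laplaceMulti_eq_sum_kronPi` of
  the structure identity below).

Not treated here: Grasedyck's integral representation `A⁻¹ = −∫₀^∞ exp(tA) dt` (Lemmas 1–2) and the
sinc-quadrature exponential sums (Lemmas 4–7); the spectral decomposition of `laplaceMulti` is the
subject of `QTTLaplaceMultiSpectrum.lean` (not imported).

References: L. Grasedyck, *Existence and computation of low Kronecker-rank approximations for large
linear systems of tensor product structure*, Computing 72 (2004) 247–265 [Grasedyck2004] (read in
the MPI MIS Leipzig Preprint 48/2003 version; its numbering is used in the cite tags);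
D. S. Bernstein, *Matrix Mathematics*, 2nd ed. (2009), Prop. 11.1.7 [Bernstein2009];
V. A. Kazeev, B. N. Khoromskij, SIAM J. Matrix Anal. Appl. 33 (2012), eq. (3)
[KazeevKhoromskij2012].
-/

noncomputable section

namespace Literature.LinearAlgebra.TensorNetworks

open Matrix Finset NormedSpace
open scoped Kronecker

/-! ### One-slot Kronecker factors: algebra -/

section OneSlot

variable {K : Type*} [CommRing K] {ι : Type*} {D : ℕ}

/-- Replacing one factor of a matrix family inside a product of entries. [folklore] -/
private theorem prod_update_entry (A : Fin D → Matrix ι ι K) (k : Fin D) (B : Matrix ι ι K)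
    (i j : Fin D → ι) :
    ∏ r, Function.update A k B r (i r) (j r) =
      B (i k) (j k) * ∏ r ∈ univ.erase k, A r (i r) (j r) := by
  rw [← Finset.mul_prod_erase _ _ (Finset.mem_univ k), Function.update_self]
  congr 1
  refine Finset.prod_congr rfl fun r hr => ?_
  rw [Function.update_of_ne (Finset.ne_of_mem_erase hr)]

/-- Scalars move into a slot: `⊗(…, c • A_k, …) = c • ⊗(…, A_k, …)`. [folklore] -/
private theorem kronPi_update_smul_aux (A : Fin D → Matrix ι ι K) (k : Fin D) (c : K)
    (B : Matrix ι ι K) :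
    kronPi (Function.update A k (c • B)) = c • kronPi (Function.update A k B) := by
  ext i j
  rw [Matrix.smul_apply, kronPi_apply, kronPi_apply, prod_update_entry, prod_update_entry,
    Matrix.smul_apply, smul_eq_mul, smul_eq_mul, mul_assoc]

variable [DecidableEq ι]

/-- **The one-slot factor is a re-indexed `A ⊗ I`**: splitting the multi-index at slot `k`
(`Equiv.funSplitAt k`), `I ⊗ ⋯ ⊗ A ⊗ ⋯ ⊗ I` becomes Mathlib's `A ⊗ₖ 1`.
[cite: Grasedyck2004, §3 eq. (2) (MIS preprint 48/2003 numbering)]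
[cite: KazeevKhoromskij2012, eq. (3)] -/
theorem kronPi_update_one_eq_reindex (k : Fin D) (A : Matrix ι ι K) :
    kronPi (Function.update (fun _ : Fin D => (1 : Matrix ι ι K)) k A) =
      Matrix.reindex (Equiv.funSplitAt k ι).symm (Equiv.funSplitAt k ι).symm
        (A ⊗ₖ (1 : Matrix ({j // j ≠ k} → ι) ({j // j ≠ k} → ι) K)) := by
  ext i j
  rw [Matrix.reindex_apply, Matrix.submatrix_apply, Equiv.symm_symm, Equiv.funSplitAt_apply,
    Equiv.funSplitAt_apply, Matrix.kroneckerMap_apply, kronPi_apply, prod_update_entry,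
    Matrix.one_apply]
  congr 1
  rw [Finset.prod_congr rfl fun r _ => (Matrix.one_apply : (1 : Matrix ι ι K) (i r) (j r) = _),
    Finset.prod_boole]
  congr 1
  apply propext
  constructor
  · intro h
    funext r
    exact h r.1 (Finset.mem_erase.2 ⟨r.2, Finset.mem_univ _⟩)
  · intro h r hr
    exact congr_fun h ⟨r, Finset.ne_of_mem_erase hr⟩

/-- One-slot factors in DIFFERENT slots multiply slot-wise ('the `Â_i` commute' — first half).
[cite: Grasedyck2004, §3 Lemma 2 (proof) (MIS preprint 48/2003 numbering)] -/
theorem kronPi_update_one_mul_of_ne [Fintype ι] {k l : Fin D} (h : k ≠ l) (A B : Matrix ι ι K) :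
    kronPi (Function.update (fun _ : Fin D => (1 : Matrix ι ι K)) k A) *
        kronPi (Function.update (fun _ : Fin D => (1 : Matrix ι ι K)) l B) =
      kronPi (Function.update (Function.update (fun _ : Fin D => (1 : Matrix ι ι K)) k A) l B) := by
  classical
  rw [kronPi_mul_kronPi]
  congr 1
  funext r
  by_cases hl : r = l
  · subst hl
    rw [Function.update_self, Function.update_of_ne (Ne.symm h), Function.update_self,
      Matrix.one_mul]
  · rw [Function.update_of_ne hl, Function.update_of_ne hl]
    by_cases hk : r = k
    · subst hk
      rw [Function.update_self, Matrix.mul_one]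
    · rw [Function.update_of_ne hk, Matrix.mul_one]

/-- **One-slot factors in different slots commute** (Grasedyck: 'the `Â_i` commute').
[cite: Grasedyck2004, §3 Lemma 2 (proof) (MIS preprint 48/2003 numbering)] -/
theorem commute_kronPi_update_one [Fintype ι] {k l : Fin D} (h : k ≠ l) (A B : Matrix ι ι K) :
    Commute (kronPi (Function.update (fun _ : Fin D => (1 : Matrix ι ι K)) k A))
      (kronPi (Function.update (fun _ : Fin D => (1 : Matrix ι ι K)) l B)) := by
  classical
  show _ * _ = _ * _
  rw [kronPi_update_one_mul_of_ne h, kronPi_update_one_mul_of_ne (Ne.symm h),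
    Function.update_comm (Ne.symm h)]

/-- `∏_{k ∈ s} (I ⊗ ⋯ ⊗ F_k ⊗ ⋯ ⊗ I) = ⊗_k (if k ∈ s then F_k else I)` (any order: the factors
commute). [cite: Grasedyck2004, §3 Lemma 2 (proof) (MIS preprint 48/2003 numbering)] -/
theorem noncommProd_kronPi_update_one [Fintype ι] (F : Fin D → Matrix ι ι K) (s : Finset (Fin D))
    (comm) :
    s.noncommProd (fun k => kronPi (Function.update (fun _ : Fin D => (1 : Matrix ι ι K)) k (F k)))
        comm = kronPi fun k => if k ∈ s then F k else 1 := by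
  classical
  induction s using Finset.induction_on with
  | empty =>
    rw [Finset.noncommProd_empty]
    simp only [Finset.notMem_empty, if_false]
    exact (kronPi_one (K := K) (ι := ι) (L := D)).symm
  | insert a s ha ih =>
    rw [Finset.noncommProd_insert_of_notMem _ _ _ _ ha, ih, kronPi_mul_kronPi]
    congr 1
    funext r
    by_cases hr : r = a
    · subst hr
      rw [Function.update_self, if_neg ha, Matrix.mul_one, if_pos (Finset.mem_insert_self _ _)]
    · rw [Function.update_of_ne hr, Matrix.one_mul]
      simp [Finset.mem_insert, hr]

/-- **Grasedyck's structure (2) is Kazeev–Khoromskij's (3)**: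
`laplaceMulti a Δ = Σ_k I ⊗ ⋯ ⊗ (a_k Δ_k) ⊗ ⋯ ⊗ I`.
[cite: Grasedyck2004, §3 eq. (2) (MIS preprint 48/2003 numbering)]
[cite: KazeevKhoromskij2012, eq. (3)] -/
theorem laplaceMulti_eq_sum_kronPi_update [Fintype ι] (a : Fin D → K)
    (Δ : Fin D → Matrix ι ι K) :
    laplaceMulti a Δ =
      ∑ k, kronPi (Function.update (fun _ : Fin D => (1 : Matrix ι ι K)) k (a k • Δ k)) := by
  unfold laplaceMulti laplaceLike
  refine Finset.sum_congr rfl fun q _ => ?_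
  congr 1
  funext r
  by_cases h : r = q
  · subst h
    simp
  · rw [Function.update_of_ne h]
    rcases lt_or_gt_of_ne h with hlt | hgt
    · simp [hlt]
    · simp [h, not_lt.2 hgt.le]

/-- Scaling the weights: `t · laplaceMulti a Δ = laplaceMulti (t a) Δ`.
[cite: KazeevKhoromskij2012, eq. (3)] -/
theorem smul_laplaceMulti [Fintype ι] (t : K) (a : Fin D → K) (Δ : Fin D → Matrix ι ι K) :
    t • laplaceMulti a Δ = laplaceMulti (fun k => t * a k) Δ := by
  rw [laplaceMulti_eq_sum_kronPi_update, laplaceMulti_eq_sum_kronPi_update, Finset.smul_sum]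
  refine Finset.sum_congr rfl fun k _ => ?_
  rw [mul_smul, kronPi_update_smul_aux _ _ t]

omit [DecidableEq ι] in
/-- `(⊗_k A_k)(⊗_k x_k) = ⊗_k (A_k x_k)` on product vectors `i ↦ ∏_k x_k(i_k)`.
[cite: Grasedyck2004, §2 (tensor vectors `⊗ x_i`) (MIS preprint 48/2003 numbering)] -/
private theorem kronPi_mulVec_prod [Fintype ι] (A : Fin D → Matrix ι ι K) (x : Fin D → ι → K) :
    kronPi A *ᵥ (fun i => ∏ k, x k (i k)) = fun i => ∏ k, (A k *ᵥ x k) (i k) := by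
  funext i
  simp only [Matrix.mulVec, dotProduct, kronPi_apply, ← Finset.prod_mul_distrib]
  exact (Fintype.prod_sum fun k j => A k (i k) j * x k j).symm

end OneSlot

/-! ### The exponential -/

section Exp

variable {𝔸 : Type*} [NormedCommRing 𝔸] [NormedAlgebra ℚ 𝔸] [CompleteSpace 𝔸]
variable {ι : Type*} [Fintype ι] [DecidableEq ι] {D : ℕ}

open Literature.Analysis.Matrix.KroneckerSum (exp_kronecker_one exp_reindex)

/-- **Bernstein (11.1.14) in an arbitrary slot**: `exp (I ⊗ ⋯ ⊗ A ⊗ ⋯ ⊗ I) = I ⊗ ⋯ ⊗ exp A ⊗ ⋯ ⊗ I`.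
[cite: Bernstein2009, Prop. 11.1.7 (11.1.14)–(11.1.15)]
[cite: Grasedyck2004, §3 Lemma 2 (proof) (MIS preprint 48/2003 numbering)] -/
theorem exp_kronPi_update_one (k : Fin D) (A : Matrix ι ι 𝔸) :
    exp (kronPi (Function.update (fun _ : Fin D => (1 : Matrix ι ι 𝔸)) k A)) =
      kronPi (Function.update (fun _ : Fin D => (1 : Matrix ι ι 𝔸)) k (exp A)) := by
  rw [kronPi_update_one_eq_reindex, kronPi_update_one_eq_reindex, exp_reindex, exp_kronecker_one]

/-- **Grasedyck, proof of Lemma 2**: `exp (Σ_k I ⊗ ⋯ ⊗ E_k ⊗ ⋯ ⊗ I) = ⊗_k exp E_k` — the summands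
commute, so the exponential of the sum is the product of the exponentials, slot by slot.
[cite: Grasedyck2004, §3 Lemma 2 (proof) (MIS preprint 48/2003 numbering)] -/
theorem exp_sum_kronPi_update_one (E : Fin D → Matrix ι ι 𝔸) :
    exp (∑ k, kronPi (Function.update (fun _ : Fin D => (1 : Matrix ι ι 𝔸)) k (E k))) =
      kronPi fun k => exp (E k) := by
  have hcomm : (↑(Finset.univ : Finset (Fin D)) : Set (Fin D)).Pairwise
      (Function.onFun Commute fun k =>
        kronPi (Function.update (fun _ : Fin D => (1 : Matrix ι ι 𝔸)) k (E k))) :=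
    fun k _ l _ hkl => commute_kronPi_update_one hkl (E k) (E l)
  rw [Matrix.exp_sum_of_commute _ _ hcomm,
    Finset.noncommProd_congr rfl (fun k _ => exp_kronPi_update_one k (E k)) _,
    noncommProd_kronPi_update_one]
  congr 1
  funext k
  rw [if_pos (Finset.mem_univ k)]

/-- **The heat semigroup of the `D`-dimensional Laplace-like operator factorises**:
`exp (Σ_k a_k I ⊗ ⋯ ⊗ Δ_k ⊗ ⋯ ⊗ I) = ⊗_k exp (a_k Δ_k)`.
[cite: Grasedyck2004, §3 Lemma 2 (proof), eq. (2) (MIS preprint 48/2003 numbering)]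
[cite: KazeevKhoromskij2012, eq. (3)] -/
theorem exp_laplaceMulti (a : Fin D → 𝔸) (Δ : Fin D → Matrix ι ι 𝔸) :
    exp (laplaceMulti a Δ) = kronPi fun k => exp (a k • Δ k) := by
  rw [laplaceMulti_eq_sum_kronPi_update, exp_sum_kronPi_update_one]

/-- Time-`t` form: `exp (t · laplaceMulti a Δ) = ⊗_k exp ((t a_k) Δ_k)` (Grasedyck's `exp(tA) =
⊗_i exp(t A_i)` with the weights absorbed).
[cite: Grasedyck2004, §3 Lemma 2 (proof) (MIS preprint 48/2003 numbering)] -/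
theorem exp_smul_laplaceMulti (t : 𝔸) (a : Fin D → 𝔸) (Δ : Fin D → Matrix ι ι 𝔸) :
    exp (t • laplaceMulti a Δ) = kronPi fun k => exp ((t * a k) • Δ k) := by
  rw [smul_laplaceMulti, exp_laplaceMulti]

/-- **Separable data stay separable**: `exp(Δ^{(D)}) (⊗_k x_k) = ⊗_k (exp(a_k Δ_k) x_k)` — the
`#ι^D`-dimensional linear evolution of a product vector is `D` evolutions of size `#ι` (Grasedyck §5
"Linear differential equations": "if `b` is a tensor vector (1), then the solution `x(t)` is
`⊗_{i=1}^d exp(tA_i) b_i` … we need to compute `d` matrix exponentials").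
[cite: Grasedyck2004, §5 with §3 Lemma 2 (MIS preprint 48/2003 numbering)] -/
theorem exp_laplaceMulti_mulVec_prod (a : Fin D → 𝔸) (Δ : Fin D → Matrix ι ι 𝔸)
    (x : Fin D → ι → 𝔸) :
    exp (laplaceMulti a Δ) *ᵥ (fun i => ∏ k, x k (i k)) =
      fun i => ∏ k, (exp (a k • Δ k) *ᵥ x k) (i k) := by
  rw [exp_laplaceMulti, kronPi_mulVec_prod]

end Exp

end Literature.LinearAlgebra.TensorNetworks
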